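import Literature.NumberTheory.Rogawski1990.KottwitzSignReadings
import HarnessLib

/-!
# Kottwitz signs, IV: the diagonal model `D = diag(a, a, b)` with Gram matrix `diag(t₀, t₁, t₂)` (Rogawski 1990, §3.8 Prop. 3.8.1 p. 30;
# §4.1 (4.1.2) pp. 39–40; §8.2 p. 117)

Topic `NumberTheory/Rogawski1990`; namespace `Literature.NumberTheory.Rogawski1990`.  THEOREMS ONLY (no definition, no named fact, no instance,
no notation, no `sorry`).  Cell `pub/hodgecm-mathlib`, ENGINE T1 (crux H413 = `stmt-HodgeConjecture-24833`), row O7 «singular semisimple classes»,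
«KOTTWITZ SIGNS» (F0P3a-plan RULING #116 (W19-1), O7 OWNER WORD #24 (B) ∕ #26 (1)(a)); sequel of ★ `KottwitzSignReadings`.  HC_CM is proved only
modulo the printed citations until rung 0 closes; this file discharges none of them.

In an adapted frame of a split-singular `γ ∈ U(H)` (★ `exists_singular_frame`: `γ P = P (a·1₂ ⊕ᶠ b·1₁)`, `ᵗ(σP) H P = H_a ⊕ᶠ H_b`, and `H_a`
diagonalised) the sign is that of the DIAGONAL MODEL by ★ `kottwitzSign_congr`; here the model is computed over any commutative ring:

* bridges `finSum_smul_one_eq_diagonal` (`a·1₂ ⊕ᶠ b·1₁ = diag(a,a,b)`), `finSum_diagonal_eq_diagonal`, `eq_diagonal_of_fin_one`;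
* `isSplitSingular_diagonal` — `diag(a,a,b)` is split-singular for `(a,b)` (`a − b` a unit, non-trivial ring);
* **`hasIsotropicEigenvector_diagonal_iff`** — the `a`-eigenvectors are `(u₀,u₁,0)`, the `b`-eigenvectors `(0,0,z)`, so an isotropic one exists
  iff the BINARY form `t₀ σ(u₀)u₀ + t₁ σ(u₁)u₁` represents `0` non-trivially or `t₂ σ(z)z = 0` for some `z ≠ 0`;
* **`kottwitzSign_diagonal_eq_neg_one_iff`** (domain, `σ` injective, `t₂ ≠ 0`): `e = −1 ↔` the binary form `⟨t₀, t₁⟩` is ANISOTROPIC — the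
  eigenPLANE decides, the eigenLINE never;
* **`kottwitzSign_eq_of_frame`** — `e_H(γ) = e_{diag(t)}(diag(a,a,b))` for a framed `γ`.

## References
* [Rogawski1990] J. D. Rogawski, *Automorphic Representations of Unitary Groups in Three Variables*, Ann. of Math. Stud. 123 (1990), §3.8
  Prop. 3.8.1 p. 30; §4.1 (4.1.2) pp. 39–40; §8.2 p. 117.
* [Kottwitz1983] R. E. Kottwitz, *Sign changes in harmonic analysis on reductive groups*, Trans. AMS 278 (1983), 289–297.
-/

set_option autoImplicit false

noncomputable section

open Matrix
open scoped MatrixGroups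

namespace Literature.NumberTheory.Rogawski1990

open Literature.AlgebraicGeometry.ShimuraVarieties (hermForm)
open Literature.NumberTheory.Automorphic.UnitaryGroup (finSum)


/-! ## §4 The diagonal model: `D = diag(a,a,b)`, Gram `diag(t₀,t₁,t₂)` -/

section Diagonal

variable {R : Type*} [CommRing R] (σ : R →+* R)

/-- `a·1₂ ⊕ᶠ b·1₁ = diag(a, a, b)` (bridge from the tree's frames ★ `exists_singular_frame`). [cite: Rogawski1990, §3.8 Prop. 3.8.1 p. 30] -/
theorem finSum_smul_one_eq_diagonal (a b : R) :
    finSum 2 1 (a • (1 : Matrix (Fin 2) (Fin 2) R)) (b • (1 : Matrix (Fin 1) (Fin 1) R)) = Matrix.diagonal ![a, a, b] := by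
  ext i j
  fin_cases i <;> fin_cases j <;> simp [finSum, Matrix.fromBlocks, Matrix.diagonal, finSumFinEquiv, Fin.addCases]

/-- `diag(p, q) ⊕ᶠ diag(r) = diag(p, q, r)`. [cite: Rogawski1990, §3.8 Prop. 3.8.1 p. 30] -/
theorem finSum_diagonal_eq_diagonal (p q r : R) :
    finSum 2 1 (Matrix.diagonal ![p, q]) (Matrix.diagonal ![r]) = Matrix.diagonal ![p, q, r] := by
  ext i j
  fin_cases i <;> fin_cases j <;> simp [finSum, Matrix.fromBlocks, Matrix.diagonal, finSumFinEquiv, Fin.addCases]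

/-- A `1 × 1` matrix is the diagonal matrix of its entry (the line block `H_b` of a singular frame). [cite: Rogawski1990, §3.8 Prop. 3.8.1 p. 30] -/
theorem eq_diagonal_of_fin_one (M : Matrix (Fin 1) (Fin 1) R) : M = Matrix.diagonal ![M 0 0] := by
  ext i j
  fin_cases i; fin_cases j
  simp

/-- `diag(a, a, b)` is split-singular for `(a, b)` when `a − b` is a unit (over a non-trivial ring). [cite: Rogawski1990, §3.8 p. 30] -/
theorem isSplitSingular_diagonal [Nontrivial R] {a b : R} (hab : IsUnit (a - b)) :
    IsSplitSingular (Matrix.diagonal ![a, a, b]) a b := by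
  have hne : a ≠ b := fun h => by
    rw [h, sub_self] at hab
    exact not_isUnit_zero hab
  refine ⟨hab, ?_, ?_, ?_⟩
  · rw [show a • (1 : Matrix (Fin 3) (Fin 3) R) = Matrix.diagonal ![a, a, a] by
        ext i j; fin_cases i <;> fin_cases j <;> simp,
      show b • (1 : Matrix (Fin 3) (Fin 3) R) = Matrix.diagonal ![b, b, b] by
        ext i j; fin_cases i <;> fin_cases j <;> simp,
      Matrix.diagonal_sub, Matrix.diagonal_sub, Matrix.diagonal_mul_diagonal]
    ext i j
    fin_cases i <;> fin_cases j <;> simp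
  · intro h
    have h1 := congrFun (congrFun h 2) 2
    simp at h1
    exact hne h1.symm
  · intro h
    have h1 := congrFun (congrFun h 0) 0
    simp at h1
    exact hne h1

/-- **Isotropic eigenvectors in the diagonal model**: for `D = diag(a,a,b)`, `a − b` a unit, and the Gram matrix `diag(t₀,t₁,t₂)`, an
`a`-eigenvector is `(u₀, u₁, 0)` and a `b`-eigenvector is `(0, 0, z)`, so an isotropic one exists iff the BINARY form
`t₀ σ(u₀)u₀ + t₁ σ(u₁)u₁` represents `0` non-trivially or `t₂ σ(z) z = 0` for some `z ≠ 0`. [cite: Rogawski1990, §3.8 Prop. 3.8.1 p. 30; §8.2 p. 117] -/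
theorem hasIsotropicEigenvector_diagonal_iff {a b : R} (hab : IsUnit (a - b)) (t : Fin 3 → R) :
    HasIsotropicEigenvector σ (Matrix.diagonal t) (Matrix.diagonal ![a, a, b]) a b ↔
      (∃ u : Fin 2 → R, u ≠ 0 ∧ t 0 * (σ (u 0) * u 0) + t 1 * (σ (u 1) * u 1) = 0) ∨
        (∃ z : R, z ≠ 0 ∧ t 2 * (σ z * z) = 0) := by
  -- the form and the action in coordinates
  have hform : ∀ v : Fin 3 → R, hermForm σ (Matrix.diagonal t) v v =
      t 0 * (σ (v 0) * v 0) + t 1 * (σ (v 1) * v 1) + t 2 * (σ (v 2) * v 2) := by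
    intro v
    simp only [hermForm, Matrix.mulVec_diagonal, dotProduct, Fin.sum_univ_three, Function.comp_apply]
    ring
  have hact : ∀ v : Fin 3 → R, Matrix.diagonal ![a, a, b] *ᵥ v = ![a * v 0, a * v 1, b * v 2] := by
    intro v
    ext i
    fin_cases i <;> simp [Matrix.mulVec_diagonal]
  -- eigenvector equations
  have heigA : ∀ v : Fin 3 → R, Matrix.diagonal ![a, a, b] *ᵥ v = a • v ↔ v 2 = 0 := by
    intro v
    rw [hact]
    constructor
    · intro h
      have h2 := congrFun h 2
      simp only [Matrix.cons_val_two, Matrix.tail_cons, Matrix.head_cons, Pi.smul_apply, smul_eq_mul] at h2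
      have h3 : (a - b) * v 2 = 0 := by rw [sub_mul, ← h2, sub_self]
      exact (hab.mul_right_eq_zero).1 h3
    · intro h
      ext i
      fin_cases i <;> simp [h]
  have heigB : ∀ v : Fin 3 → R, Matrix.diagonal ![a, a, b] *ᵥ v = b • v ↔ v 0 = 0 ∧ v 1 = 0 := by
    intro v
    rw [hact]
    constructor
    · intro h
      have h0 := congrFun h 0
      have h1 := congrFun h 1
      simp only [Matrix.cons_val_zero, Matrix.cons_val_one, Pi.smul_apply, smul_eq_mul] at h0 h1
      have h0' : (a - b) * v 0 = 0 := by rw [sub_mul, h0, sub_self]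
      have h1' : (a - b) * v 1 = 0 := by rw [sub_mul, h1, sub_self]
      exact ⟨(hab.mul_right_eq_zero).1 h0', (hab.mul_right_eq_zero).1 h1'⟩
    · rintro ⟨h0, h1⟩
      ext i
      fin_cases i <;> simp [h0, h1]
  constructor
  · rintro ⟨v, hv0, hev, hiso⟩
    rw [hform] at hiso
    rcases hev with hev | hev
    · -- an `a`-eigenvector: last coordinate vanishes
      have h2 := (heigA v).1 hev
      left
      refine ⟨![v 0, v 1], ?_, ?_⟩
      · intro h0
        apply hv0
        have e0 := congrFun h0 0
        have e1 := congrFun h0 1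
        simp only [Matrix.cons_val_zero, Matrix.cons_val_one, Pi.zero_apply] at e0 e1
        ext i
        fin_cases i <;> simp [e0, e1, h2]
      · simp only [Matrix.cons_val_zero, Matrix.cons_val_one]
        rw [h2, map_zero, zero_mul, mul_zero, add_zero] at hiso
        exact hiso
    · -- a `b`-eigenvector: first two coordinates vanish
      obtain ⟨h0, h1⟩ := (heigB v).1 hev
      right
      refine ⟨v 2, ?_, ?_⟩
      · intro hz
        apply hv0
        ext i
        fin_cases i <;> simp [h0, h1, hz]
      · rw [h0, h1, map_zero, zero_mul, mul_zero, mul_zero, zero_add, zero_add] at hiso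
        exact hiso
  · rintro (⟨u, hu0, hu⟩ | ⟨z, hz0, hz⟩)
    · refine ⟨![u 0, u 1, 0], ?_, Or.inl ((heigA _).2 rfl), ?_⟩
      · intro h0
        apply hu0
        have e0 := congrFun h0 0
        have e1 := congrFun h0 1
        simp only [Matrix.cons_val_zero, Matrix.cons_val_one, Pi.zero_apply] at e0 e1
        ext i
        fin_cases i <;> simp [e0, e1]
      · rw [hform]
        simp only [Matrix.cons_val_zero, Matrix.cons_val_one, Matrix.cons_val_two, Matrix.head_cons, Matrix.tail_cons, map_zero,
          mul_zero, add_zero]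
        exact hu
    · refine ⟨![0, 0, z], ?_, Or.inr ((heigB _).2 ⟨rfl, rfl⟩), ?_⟩
      · intro h0
        apply hz0
        have e2 := congrFun h0 2
        simpa using e2
      · rw [hform]
        simp only [Matrix.cons_val_zero, Matrix.cons_val_one, Matrix.cons_val_two, Matrix.head_cons, Matrix.tail_cons, map_zero,
          mul_zero, zero_add]
        exact hz

/-- **The sign in the diagonal model over a DOMAIN** (`σ` injective, `t₂ ≠ 0`, `a − b` a unit): `e = −1 ↔` the binary form `⟨t₀, t₁⟩` is
ANISOTROPIC (`t₀ σ(u₀)u₀ + t₁ σ(u₁)u₁ = 0 ⇒ u = 0`). [cite: Rogawski1990, §4.1 (4.1.2) p. 39; §8.2 p. 117] -/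
theorem kottwitzSign_diagonal_eq_neg_one_iff {K : Type*} [CommRing K] [IsDomain K] (τ : K →+* K) (hτ : Function.Injective τ)
    {a b : K} (hab : IsUnit (a - b)) (t : Fin 3 → K) (ht2 : t 2 ≠ 0) :
    kottwitzSign τ (Matrix.diagonal t) (Matrix.diagonal ![a, a, b]) = -1 ↔
      ∀ u : Fin 2 → K, t 0 * (τ (u 0) * u 0) + t 1 * (τ (u 1) * u 1) = 0 → u = 0 := by
  rw [kottwitzSign_eq_neg_one_iff_not_hasIsotropicEigenvector (isSplitSingular_diagonal hab), hasIsotropicEigenvector_diagonal_iff τ hab t,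
    not_or]
  constructor
  · rintro ⟨h1, -⟩ u hu
    by_contra hu0
    exact h1 ⟨u, hu0, hu⟩
  · intro h
    refine ⟨fun ⟨u, hu0, hu⟩ => hu0 (h u hu), fun ⟨z, hz0, hz⟩ => ?_⟩
    rcases mul_eq_zero.1 hz with h1 | h1
    · exact ht2 h1
    · rcases mul_eq_zero.1 h1 with h2 | h2
      · exact hz0 (hτ (by rw [h2, map_zero]))
      · exact hz0 h2

/-- **Reduction of a framed element to the diagonal model**: if `γ P = P (a·1₂ ⊕ᶠ b·1₁)` and `ᵗ(σP) H P = diag(t₀,t₁) ⊕ᶠ diag(t₂)` then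
`e_H(γ) = e_{diag(t)}(diag(a,a,b))` (★ `kottwitzSign_congr` with `T = P`). [cite: Rogawski1990, §3.8 Prop. 3.8.1 p. 30; §4.1 (4.1.2) p. 39] -/
theorem kottwitzSign_eq_of_frame (H : Matrix (Fin 3) (Fin 3) R) {X : Matrix (Fin 3) (Fin 3) R} (P : GL (Fin 3) R) {a b : R}
    (hXP : X * (P : Matrix (Fin 3) (Fin 3) R) =
      (P : Matrix (Fin 3) (Fin 3) R) * finSum 2 1 (a • (1 : Matrix (Fin 2) (Fin 2) R)) (b • (1 : Matrix (Fin 1) (Fin 1) R)))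
    (t : Fin 3 → R) (hHP : ((P : Matrix (Fin 3) (Fin 3) R).map σ)ᵀ * H * (P : Matrix (Fin 3) (Fin 3) R) = Matrix.diagonal t) :
    kottwitzSign σ H X = kottwitzSign σ (Matrix.diagonal t) (Matrix.diagonal ![a, a, b]) := by
  have hPi : ((P⁻¹ : GL (Fin 3) R) : Matrix (Fin 3) (Fin 3) R) * (P : Matrix (Fin 3) (Fin 3) R) = 1 := by
    rw [← Units.val_mul, inv_mul_cancel, Units.val_one]
  have hD : ((P⁻¹ : GL (Fin 3) R) : Matrix (Fin 3) (Fin 3) R) * X * (P : Matrix (Fin 3) (Fin 3) R) = Matrix.diagonal ![a, a, b] := by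
    rw [Matrix.mul_assoc, hXP, ← Matrix.mul_assoc, hPi, Matrix.one_mul, finSum_smul_one_eq_diagonal]
  rw [← hD, ← hHP, kottwitzSign_congr]

end Diagonal

end Literature.NumberTheory.Rogawski1990

end
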